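import Literature.AlgebraicGeometry.Resolution.CobordantBlowupGlobal
import Literature.AlgebraicGeometry.Resolution.NonPrincipalLocus
import Literature.AlgebraicGeometry.Resolution.HypersurfaceTransform
import Literature.AlgebraicGeometry.Resolution.MarkedIdealsHomogenized
import Literature.AlgebraicGeometry.Resolution.StalkIdealLemmas
import Literature.AlgebraicGeometry.Resolution.IdealSheafLemmas
import Literature.AlgebraicGeometry.Resolution.AffineBlowupCartier
import Literature.AlgebraicGeometry.Resolution.RegularLocalRingsUFD
import Literature.AlgebraicGeometry.Resolution.RegularLocalRingsProofs
import Summits.ResolutionOfSingularities.ResolutionOfSingularities.Theorems.WeightedInvariantWeightedThesisGlobalCobordantPlus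
import Mathlib.RingTheory.UniqueFactorizationDomain.GCDMonoid
import HarnessLib

/-!
# `WeightedThesis` — hypersurfaces are preserved by the global cobordant blow-up

Support for crux `stmt-ResolutionOfSingularities-0569`
(`Summit.ResolutionOfSingularities.ResolutionOfSingularities.Theses.WeightedInvariant.WeightedThesis`),
line `datum-glued-split`, RESHAPE 7 (lead c7): the cobordant tower run with a HYPERSURFACE datum
(`Theorems/WeightedInvariantWeightedThesisHypersurfaceDatum.lean`) must know that every pair it visits is
again a hypersurface pair. On the GLOBAL cobordant blow-up `B = R'.cobordantBlowup = Spec_Y ⊕ₙ 𝒥ₙ tⁿ`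
(`Literature/…/CobordantBlowupGlobal.lean`) of a regular weighted centre on a regular locally Noetherian
`Y`, the strict transform `σˢ(K) = ⋃ₙ (π^*K : (t⁻¹)ⁿ)` of a LOCALLY PRINCIPAL ideal sheaf `K` is locally
principal, and so is its restriction `R'.strictTransformPlus K` to `B₊` (Włodarczyk, arXiv:2203.03090,
3.3.12 with 2.3.9: `B` is regular, hence locally factorial, and the saturation of a principal ideal by
a principal ideal in a factorial domain is principal). The affine special case over a chart with PRIME
centre is `Theorems/…PrincipalStrictTransform.lean`; here the argument is run in the STALKS of `B`,
which are regular local rings, hence unique factorisation domains (Auslander–Buchsbaum, tree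
`RegularLocalRingsUFD`), so no primality of the centre on the chart is needed:

* `isPrincipal_colon_span_singleton_span_singleton` — in a GCD domain `((g) : (c)) = (g / gcd(g, c))`
  is principal; `isPrincipal_iSup_colon_span_singleton_pow` — in a Noetherian factorial domain the
  saturation `⋃ₙ ((g) : (s)ⁿ)` is principal (the chain is stationary);
* `isLocallyPrincipal_iSup_colon_pow` — on a regular locally Noetherian scheme the saturation
  `⋃ₙ (K : Eⁿ)` of a locally principal `K` by a locally principal `E` is locally principal (local
  principality is a stalk condition, `isLocallyPrincipalAt_iff_isPrincipal_stalkIdeal`);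
* `isLocallyPrincipal_exc` — the exceptional ideal `(t⁻¹)` of `B` is locally principal;
* `isLocallyPrincipal_strictTransform`, `isLocallyPrincipal_strictTransformPlus` (registered stub) — the
  statements above for `σˢ(K)` on `B` and on `B₊`.
-/

noncomputable section

open CategoryTheory CategoryTheory.Limits AlgebraicGeometry TopologicalSpace
open Literature.AlgebraicGeometry.Resolution
open Summit.ResolutionOfSingularities.ResolutionOfSingularities.Theorems.WeightedThesis

set_option linter.dupNamespace false -- mandated namespace of this single-conjunct summit

namespace Summit.ResolutionOfSingularities.ResolutionOfSingularities.Theorems.WeightedThesis.HypersurfacePreserved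

universe u

/-! ## Saturations of principal ideals in factorial domains -/

section Algebra

variable {A : Type*} [CommRing A] [IsDomain A]

/-- **In a GCD domain the colon of two principal ideals is principal**: `((g) : (c)) = (g')` where
`g = gcd(g, c) · g'` (and `((0) : (c))` is `(0)` or the unit ideal). [folklore] -/
theorem isPrincipal_colon_span_singleton_span_singleton [GCDMonoid A] (g c : A) :
    (Submodule.colon (Ideal.span {g}) ((Ideal.span {c} : Ideal A) : Set A)).IsPrincipal := by
  rw [Ideal.colon_span]
  by_cases hg : g = 0
  · subst hg
    by_cases hc : c = 0
    · subst hc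
      rw [Submodule.colon_singleton_zero]
      exact ⟨⟨1, by rw [Ideal.submodule_span_eq, Ideal.span_singleton_one]⟩⟩
    · refine ⟨⟨0, ?_⟩⟩
      rw [Ideal.submodule_span_eq, Ideal.span_singleton_zero, eq_bot_iff]
      intro r hr
      rw [Submodule.mem_colon_singleton, smul_eq_mul, Ideal.mem_bot, mul_eq_zero] at hr
      exact (Ideal.mem_bot).mpr (hr.resolve_right hc)
  · -- `g = d g'`, `c = d e` with `d = gcd g c`; the colon is `(g')`
    have hd0 : gcd g c ≠ 0 := fun h => hg ((gcd_eq_zero_iff g c).mp h).1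
    obtain ⟨g', hg'⟩ : gcd g c ∣ g := gcd_dvd_left g c
    obtain ⟨e, he⟩ : gcd g c ∣ c := gcd_dvd_right g c
    generalize hd : gcd g c = d at hd0 hg' he
    subst hg' he
    refine ⟨⟨g', ?_⟩⟩
    rw [Ideal.submodule_span_eq]
    ext r
    rw [Submodule.mem_colon_singleton, smul_eq_mul, Ideal.mem_span_singleton,
      Ideal.mem_span_singleton]
    constructor
    · intro h
      -- `d g' ∣ r · d e` gives `d g' ∣ gcd · r = d r`, so `g' ∣ r`
      have h1 : d * g' ∣ d * e * r := by
        have e1 : d * e * r = r * (d * e) := by ring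
        rw [e1]
        exact h
      have h2 : d * g' ∣ d * r := by
        have := dvd_gcd_mul_of_dvd_mul h1
        rwa [hd] at this
      exact (mul_dvd_mul_iff_left hd0).mp h2
    · rintro ⟨t, rfl⟩
      -- `g' t · d e = d g' · (t e)`
      exact ⟨t * e, by ring⟩

omit [IsDomain A] in
/-- The chain `n ↦ ((g) : (s)ⁿ)` of colon ideals is monotone. [folklore] -/
theorem monotone_colon_span_singleton_pow (g s : A) :
    Monotone fun n : ℕ => Submodule.colon (Ideal.span {g}) ((Ideal.span {s} ^ n : Ideal A) : Set A) :=
  fun _ _ h => Submodule.colon_mono le_rfl (Ideal.pow_le_pow_right h)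

/-- **In a Noetherian factorial domain the saturation `⋃ₙ ((g) : (s)ⁿ)` of a principal ideal by a
principal ideal is principal**: the chain is stationary (Noetherian) and each term is principal
(`isPrincipal_colon_span_singleton_span_singleton`, `(s)ⁿ = (sⁿ)`). [folklore] -/
theorem isPrincipal_iSup_colon_span_singleton_pow [IsNoetherianRing A] [UniqueFactorizationMonoid A]
    (g s : A) :
    (⨆ n : ℕ, Submodule.colon (Ideal.span {g}) ((Ideal.span {s} ^ n : Ideal A) : Set A)).IsPrincipal := by
  classical
  letI : GCDMonoid A := UniqueFactorizationMonoid.toGCDMonoid A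
  let f : ℕ →o Ideal A :=
    ⟨fun n => Submodule.colon (Ideal.span {g}) ((Ideal.span {s} ^ n : Ideal A) : Set A),
      monotone_colon_span_singleton_pow g s⟩
  obtain ⟨N, hN⟩ := monotone_stabilizes_iff_noetherian.mpr (inferInstance : IsNoetherian A A) f
  have hsup : (⨆ n : ℕ, Submodule.colon (Ideal.span {g}) ((Ideal.span {s} ^ n : Ideal A) : Set A)) =
      f N := by
    apply le_antisymm
    · refine iSup_le fun n => ?_
      rcases le_total n N with h | h
      · exact f.monotone h
      · exact (hN n h).symm.le
    · exact le_iSup (fun n : ℕ =>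
        Submodule.colon (Ideal.span {g}) ((Ideal.span {s} ^ n : Ideal A) : Set A)) N
  rw [hsup]
  change (Submodule.colon (Ideal.span {g}) ((Ideal.span {s} ^ N : Ideal A) : Set A)).IsPrincipal
  rw [Ideal.span_singleton_pow]
  exact isPrincipal_colon_span_singleton_span_singleton g (s ^ N)

end Algebra

/-! ## Saturations of locally principal ideal sheaves on regular schemes -/

section Scheme

variable {B : Scheme.{u}} [IsLocallyNoetherian B]

/-- **On a regular locally Noetherian scheme the saturation `⋃ₙ (K : Eⁿ)` of a locally principal
ideal sheaf `K` by a locally principal ideal sheaf `E` is locally principal**: local principality is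
a stalk condition (`isLocallyPrincipalAt_iff_isPrincipal_stalkIdeal`), stalks commute with suprema,
colons and powers, and the stalks of `B` are regular local rings, hence Noetherian factorial domains
(Auslander–Buchsbaum, `uniqueFactorizationMonoid_of_isRegularLocalRing`), where
`isPrincipal_iSup_colon_span_singleton_pow` applies. [cite: Wlodarczyk2022, 3.3.12 and 2.3.9] -/
theorem isLocallyPrincipal_iSup_colon_pow (hB : Scheme.IsRegular B) {K E : B.IdealSheafData}
    (hK : IsLocallyPrincipal K) (hE : IsLocallyPrincipal E) :
    IsLocallyPrincipal (⨆ n : ℕ, colon K (E ^ n)) := by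
  intro b
  apply isLocallyPrincipalAt_of_isPrincipal_stalkIdeal
  rw [stalkIdeal_iSup]
  simp_rw [stalkIdeal_colon, stalkIdeal_pow]
  obtain ⟨g, hg⟩ := (hK b).isPrincipal_stalkIdeal
  obtain ⟨s, hs⟩ := (hE b).isPrincipal_stalkIdeal
  rw [Ideal.submodule_span_eq] at hg hs
  rw [hg, hs]
  haveI : IsRegularLocalRing (B.presheaf.stalk b) := hB b
  haveI : IsDomain (B.presheaf.stalk b) := isDomain_of_isRegularLocalRing _
  haveI : UniqueFactorizationMonoid (B.presheaf.stalk b) :=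
    uniqueFactorizationMonoid_of_isRegularLocalRing _ (hB b)
  exact isPrincipal_iSup_colon_span_singleton_pow g s

end Scheme

/-! ## The global cobordant blow-up -/

section Cobordant

variable {Y : Scheme.{u}} (R : ReesAlgebraData Y) (R' : ReesFiltration Y) (hR' : R'.ideal = R.piece)

/-- The ideal sheaf of a principal ideal on an affine scheme `Spec A` is locally principal.
[folklore] -/
theorem isLocallyPrincipal_idealSheaf_span_singleton {A : Type u} [CommRing A] (v : A) :
    IsLocallyPrincipal (affineBlowup.idealSheaf (Ideal.span {v})) := fun _ =>
  isLocallyPrincipalAt_of_ideal_eq_span (U := ⟨⊤, isAffineOpen_top _⟩)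
    (by rw [affineBlowup.idealSheaf, ideal_ofIdealTop_top, Ideal.map_span, Set.image_singleton])
    trivial

/-- **The exceptional ideal `(t⁻¹)` of the global cobordant blow-up is locally principal** (it is
the inverse image of the ideal of the origin of `𝔸¹` under `t⁻¹ : B ⟶ 𝔸¹`).
[cite: Wlodarczyk2022, Lemma 2.3.8] -/
theorem isLocallyPrincipal_exc : IsLocallyPrincipal R'.exc :=
  (isLocallyPrincipal_idealSheaf_span_singleton _).comap R'.toA1

include hR' in
/-- **The strict transform of a hypersurface on the global full cobordant blow-up is a
hypersurface**: for a regular weighted centre `R` on a regular locally Noetherian `Y` and a Rees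
filtration `R'` with the pieces of `R`, the strict transform `σˢ(K) = ⋃ₙ (π^*K : (t⁻¹)ⁿ)` on
`B = Spec_Y ⊕ₙ 𝒥ₙ tⁿ` of a locally principal ideal sheaf `K` of `Y` is locally principal (`B` is
regular, `GlobalCobordantPlus.isRegular_cobordantBlowup`, Włodarczyk §2.3.9; then
`isLocallyPrincipal_iSup_colon_pow`). [cite: Wlodarczyk2022, 3.3.12 and 2.3.9] -/
theorem isLocallyPrincipal_strictTransform [IsLocallyNoetherian Y] (hY : Scheme.IsRegular Y)
    (hc : R.IsRegularWeightedCentre) {K : Y.IdealSheafData} (hK : IsLocallyPrincipal K) :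
    IsLocallyPrincipal (R'.strictTransform K) := by
  haveI : LocallyOfFiniteType R'.π := GlobalCobordantPlus.locallyOfFiniteType_π R R' hR' hc
  haveI : IsLocallyNoetherian R'.cobordantBlowup := LocallyOfFiniteType.isLocallyNoetherian R'.π
  have hB : Scheme.IsRegular R'.cobordantBlowup :=
    GlobalCobordantPlus.isRegular_cobordantBlowup R R' hR' hY hc
  exact isLocallyPrincipal_iSup_colon_pow hB (hK.comap R'.π) (isLocallyPrincipal_exc R')

/-- **The strict transform of a hypersurface on the cobordant blow-up `B₊` is a hypersurface**
(registered stub of line `datum-glued-split`, RESHAPE 7): for a regular weighted centre `R` on a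
regular locally Noetherian scheme `Y`, a Rees filtration `R'` with the pieces of `R`, and a locally
principal ideal sheaf `K` on `Y`, the strict transform `R'.strictTransformPlus K` on
`B₊ = R'.plus` is locally principal — so the class of hypersurface pairs is stable under the move of
a weighted resolution datum. [cite: Wlodarczyk2022, 3.3.12 and 2.3.9] -/
theorem isLocallyPrincipal_strictTransformPlus : ∀ {Y : AlgebraicGeometry.Scheme.{0}} [AlgebraicGeometry.IsLocallyNoetherian Y], Literature.AlgebraicGeometry.Resolution.Scheme.IsRegular Y → ∀ (R : Literature.AlgebraicGeometry.Resolution.ReesAlgebraData Y), R.IsRegularWeightedCentre → ∀ (R' : Literature.AlgebraicGeometry.Resolution.ReesFiltration Y), R'.ideal = R.piece → ∀ (K : Y.IdealSheafData), Literature.AlgebraicGeometry.Resolution.IsLocallyPrincipal K → Literature.AlgebraicGeometry.Resolution.IsLocallyPrincipal (R'.strictTransformPlus K) := by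
  intro Y _ hY R hc R' hR' K hK
  exact (isLocallyPrincipal_strictTransform R R' hR' hY hc hK).comap R'.plus.ι

end Cobordant

end Summit.ResolutionOfSingularities.ResolutionOfSingularities.Theorems.WeightedThesis.HypersurfacePreserved

end
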